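import Summits.ABC.ABC.Theses.FeketeScales
import Summits.ABC.ABC.Theorems.FeketeScalesSubmultOfRST
import Summits.ABC.ABC.Theorems.FeketeScalesTargetOfCruxes
import Literature.Barriers.ABC.EpsilonCannotBeDroppedHolds
import Literature.Barriers.ABC.EpsilonCannotBeDroppedProofs
import Literature.Barriers.ABC.ExplicitABCQualityFloor

/-!
# Crux stmt-ABC-2159 (`FeketeScales.Target`) — ideator 2 sketch: quasi-polynomial constant
calibration and the ω-split

First lemmas of the crux idea `polyconstant-omega-split` (planner-cruxidea-stmt-ABC-2159-2-0,
round 1).  Everything here is PROVED (rc 0, no sorry, axioms propext / Classical.choice / Quot.sound):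

* `PolyConstantABC` (abc with `C(ε) = exp(A ε^{-κ})`) and `SubPowerSlack` (`c < rad · exp(A (log rad)^τ)`,
  `τ < 1`, the hypothesis of the route's support `SubmultOfRST`); the Legendre step
  `subPowerSlack_of_polyConstant` (`τ = κ/(κ+1)`), `abc_of_polyConstant`, `abc_of_subPowerSlack`,
  `sparseGoodScales_of_abc : ABC → SparseGoodScales`, and **`target_of_polyConstant : PolyConstantABC → Target`**.
* The ω-split: `SmallOmegaBaker θ'` (Baker's Conjecture 12.2.6 shape `K A^ω (N ε^{-ω})^{1+ε}` asked only of
  triples with `ω(abc) ≤ (log N)^{θ'}`) and `LargeOmegaSubPower θ' θ` (sub-power excess for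
  `ω(abc) > (log N)^{θ'}`); `smallOmega_core` (the optimisation `ε = L^{θ'-1}`) and
  **`target_of_omegaSplit : 0 < θ' → θ' < θ → θ < 1 → SmallOmegaBaker θ' → LargeOmegaSubPower θ' θ → Target`**.
* Sources of the stubs: `polyConstant_of_RST` / `target_of_RST` (RST Conjecture A, upper half, gives
  `PolyConstantABC` with `κ = 1`, hence `Target`) and `smallOmegaBaker_of_bakerShape`
  (route LogCardinality's target `∃ κ, BakerShapeExplicitABC κ` gives `SmallOmegaBaker θ'` for every `θ'`).
* Floor of the window: `not_subPowerSlack_of_lt_half` — no sub-power slack with `τ < 1/2` (equivalently no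
  quasi-polynomial constant with `κ < 1`) holds, by Stewart–Tijdeman (`EpsilonCannotBeDropped_holds`).
-/

set_option linter.dupNamespace false

namespace Summit.ABC.ABC.Cruxes.Target.PolyconstantOmegaSplit

open Literature.NumberTheory.DiophantineGeometry
open Summit.ABC.ABC.Theses.FeketeScales

/-- **abc with quasi-polynomial constant** (`C(ε) = exp(A ε^{-κ})`): there are `κ, A` such that for
every `0 < ε ≤ 1` every abc triple satisfies `c ≤ exp(A ε^{-κ}) · rad(abc)^{1+ε}`. -/
def PolyConstantABC : Prop :=
  ∃ κ A : ℝ, ∀ ε : ℝ, 0 < ε → ε ≤ 1 → ∀ a b c : ℕ, IsABCTriple a b c →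
    (c : ℝ) ≤ Real.exp (A * ε ^ (-κ)) * ((rad a b c : ℕ) : ℝ) ^ (1 + ε)

/-- **Sub-power slack** (the hypothesis of the route's support item `SubmultOfRST`): for some `τ < 1`
and some real `A`, every abc triple has `c < rad · exp(A (log rad)^τ)`. -/
def SubPowerSlack : Prop :=
  ∃ τ : ℝ, τ < 1 ∧ ∃ A : ℝ, ∀ a b c : ℕ, IsABCTriple a b c →
    (c : ℝ) < ((rad a b c : ℕ) : ℝ) * Real.exp (A * Real.log ((rad a b c : ℕ) : ℝ) ^ τ)

/-- **Small-ω stub**: Baker's Conjecture 12.2.6 (Bombieri–Gubler), `c ≤ K (N ε^{-ω})^{1+ε}` for all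
`0 < ε ≤ 1`, weakened by an arbitrary geometric factor `A^ω` and demanded ONLY of the triples with few
prime factors, `ω(abc) ≤ (log N)^{θ'}` (`N = rad(abc)`, `ω = ω(abc)`). -/
def SmallOmegaBaker (θ' : ℝ) : Prop :=
  ∃ K A : ℝ, 0 < K ∧ 1 ≤ A ∧ ∀ ε : ℝ, 0 < ε → ε ≤ 1 → ∀ a b c : ℕ, IsABCTriple a b c →
    ((ArithmeticFunction.cardDistinctFactors (a * b * c) : ℕ) : ℝ)
        ≤ Real.log ((rad a b c : ℕ) : ℝ) ^ θ' →
    (c : ℝ) ≤ K * A ^ (ArithmeticFunction.cardDistinctFactors (a * b * c) : ℕ) *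
      (((rad a b c : ℕ) : ℝ) * ε ^ (-((ArithmeticFunction.cardDistinctFactors (a * b * c) : ℕ) : ℝ)))
        ^ (1 + ε)

/-- **Large-ω stub**: sub-power excess for the triples with MANY prime factors,
`ω(abc) > (log N)^{θ'}`: `c < N · exp(A (log N)^θ)`. -/
def LargeOmegaSubPower (θ' θ : ℝ) : Prop :=
  ∃ A : ℝ, ∀ a b c : ℕ, IsABCTriple a b c →
    Real.log ((rad a b c : ℕ) : ℝ) ^ θ'
        < ((ArithmeticFunction.cardDistinctFactors (a * b * c) : ℕ) : ℝ) →
    (c : ℝ) < ((rad a b c : ℕ) : ℝ) * Real.exp (A * Real.log ((rad a b c : ℕ) : ℝ) ^ θ)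

theorem subPowerSlack_of_polyConstant : PolyConstantABC → SubPowerSlack := by
  rintro ⟨κ, A, h⟩
  -- normalise the exponent and the constant: `k := max κ 0 ≥ 0`, `B := |A| ≥ 0`
  set k : ℝ := max κ 0 with hk
  have hk0 : 0 ≤ k := le_max_right _ _
  have hκk : κ ≤ k := le_max_left _ _
  set B : ℝ := |A| with hB
  have hB0 : 0 ≤ B := abs_nonneg A
  -- pointwise: for `0 < ε ≤ 1`, `log c ≤ B ε^{-k} + (1+ε) log rad`
  have key : ∀ ε : ℝ, 0 < ε → ε ≤ 1 → ∀ a b c : ℕ, IsABCTriple a b c →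
      Real.log (c : ℝ) ≤ B * ε ^ (-k) + (1 + ε) * Real.log ((rad a b c : ℕ) : ℝ) := by
    intro ε hε hε1 a b c habc
    have hc0 : (0 : ℝ) < (c : ℝ) := by
      obtain ⟨ha, hb, habc', -⟩ := habc; exact_mod_cast (show 0 < c by omega)
    have hrad2 : (2 : ℝ) ≤ ((rad a b c : ℕ) : ℝ) := by
      exact_mod_cast Summit.ABC.ABC.Theorems.SubmultOfRST.two_le_rad habc
    have hrad0 : (0 : ℝ) < ((rad a b c : ℕ) : ℝ) := by linarith
    have h1 := h ε hε hε1 a b c habc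
    have h2 : Real.log (c : ℝ)
        ≤ Real.log (Real.exp (A * ε ^ (-κ)) * ((rad a b c : ℕ) : ℝ) ^ (1 + ε)) :=
      Real.log_le_log hc0 h1
    rw [Real.log_mul (Real.exp_pos _).ne' (Real.rpow_pos_of_pos hrad0 _).ne', Real.log_exp,
      Real.log_rpow hrad0] at h2
    have hεk : ε ^ (-κ) ≤ ε ^ (-k) := Real.rpow_le_rpow_of_exponent_ge hε hε1 (by linarith)
    have hεκ0 : 0 ≤ ε ^ (-κ) := Real.rpow_nonneg hε.le _
    have hAB : A * ε ^ (-κ) ≤ B * ε ^ (-k) :=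
      calc A * ε ^ (-κ) ≤ |A| * ε ^ (-κ) := mul_le_mul_of_nonneg_right (le_abs_self A) hεκ0
        _ ≤ |A| * ε ^ (-k) := mul_le_mul_of_nonneg_left hεk (abs_nonneg A)
    linarith
  -- the exponent `τ := k/(k+1) ∈ [0,1)` (Legendre duality `κ ↦ κ/(κ+1)`)
  have hk1 : 0 < k + 1 := by linarith
  set τ : ℝ := k / (k + 1) with hτ
  have hτ1 : τ < 1 := by rw [hτ, div_lt_one hk1]; linarith
  have hτ0 : 0 ≤ τ := div_nonneg hk0 hk1.le
  have hlog2 : 0 < Real.log 2 := Real.log_pos one_lt_two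
  have hl2τ : 0 < Real.log 2 ^ τ := Real.rpow_pos_of_pos hlog2 _
  set A' : ℝ := (B + 2) / Real.log 2 ^ τ + (B + 1) + 1 with hA'
  have hA'1 : 0 ≤ (B + 2) / Real.log 2 ^ τ := div_nonneg (by linarith) hl2τ.le
  refine ⟨τ, hτ1, A', ?_⟩
  intro a b c habc
  have hc0 : (0 : ℝ) < (c : ℝ) := by
    obtain ⟨ha, hb, habc', -⟩ := habc; exact_mod_cast (show 0 < c by omega)
  have hrad2 : (2 : ℝ) ≤ ((rad a b c : ℕ) : ℝ) := by
    exact_mod_cast Summit.ABC.ABC.Theorems.SubmultOfRST.two_le_rad habc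
  have hrad0 : (0 : ℝ) < ((rad a b c : ℕ) : ℝ) := by linarith
  set L : ℝ := Real.log ((rad a b c : ℕ) : ℝ) with hL
  have hL2 : Real.log 2 ≤ L := Real.log_le_log two_pos hrad2
  have hL0 : 0 < L := hlog2.trans_le hL2
  have hLτ0 : 0 < L ^ τ := Real.rpow_pos_of_pos hL0 _
  have hLτ2 : Real.log 2 ^ τ ≤ L ^ τ := Real.rpow_le_rpow hlog2.le hL2 hτ0
  -- main claim: `log c ≤ L + (A' - 1) L^τ`
  have main : Real.log (c : ℝ) ≤ L + (A' - 1) * L ^ τ := by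
    rcases le_or_gt 1 L with hL1 | hL1
    · -- `L ≥ 1`: take `ε := L^{-1/(k+1)}`, so that `ε^{-k} = ε L = L^τ`
      set ε : ℝ := L ^ (-(1 / (k + 1))) with hε
      have hε0 : 0 < ε := Real.rpow_pos_of_pos hL0 _
      have hexpneg : -(1 / (k + 1)) ≤ 0 := by
        have : 0 < 1 / (k + 1) := by positivity
        linarith
      have hε1 : ε ≤ 1 := Real.rpow_le_one_of_one_le_of_nonpos hL1 hexpneg
      have hk' := key ε hε0 hε1 a b c habc
      have hεk : ε ^ (-k) = L ^ τ := by
        rw [hε, ← Real.rpow_mul hL0.le]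
        congr 1
        rw [hτ]; field_simp
      have hεL : ε * L = L ^ τ := by
        have e1 : ε * L = L ^ (-(1 / (k + 1)) + 1) := by
          rw [Real.rpow_add hL0, Real.rpow_one]
        rw [e1]; congr 1; rw [hτ]; field_simp; ring
      have e2 : B * ε ^ (-k) + (1 + ε) * L = L + (B + 1) * L ^ τ := by
        rw [hεk, add_mul, one_mul, hεL]; ring
      rw [e2] at hk'
      have hcoef : (B + 1) * L ^ τ ≤ (A' - 1) * L ^ τ := by
        apply mul_le_mul_of_nonneg_right _ hLτ0.le
        rw [hA']; linarith
      linarith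
    · -- `L < 1`: take `ε := 1`
      have hk' := key 1 one_pos le_rfl a b c habc
      rw [Real.one_rpow, mul_one] at hk'
      -- `(A' - 1) L^τ ≥ (B+2)/(log 2)^τ · L^τ ≥ B + 2`
      have h3 : B + 2 ≤ (B + 2) / Real.log 2 ^ τ * L ^ τ := by
        rw [div_mul_eq_mul_div, le_div_iff₀ hl2τ]
        exact mul_le_mul_of_nonneg_left hLτ2 (by linarith)
      have h4 : (B + 2) / Real.log 2 ^ τ * L ^ τ ≤ (A' - 1) * L ^ τ := by
        apply mul_le_mul_of_nonneg_right _ hLτ0.le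
        rw [hA']; linarith
      linarith
  -- exponentiate: `c ≤ rad · exp((A'-1) L^τ) < rad · exp(A' L^τ)`
  have hexp : (c : ℝ) ≤ ((rad a b c : ℕ) : ℝ) * Real.exp ((A' - 1) * L ^ τ) := by
    calc (c : ℝ) = Real.exp (Real.log (c : ℝ)) := (Real.exp_log hc0).symm
      _ ≤ Real.exp (L + (A' - 1) * L ^ τ) := Real.exp_le_exp.mpr main
      _ = ((rad a b c : ℕ) : ℝ) * Real.exp ((A' - 1) * L ^ τ) := by
          rw [Real.exp_add, hL, Real.exp_log hrad0]
  have hlt : Real.exp ((A' - 1) * L ^ τ) < Real.exp (A' * L ^ τ) := by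
    apply Real.exp_lt_exp.mpr; nlinarith
  calc (c : ℝ) ≤ ((rad a b c : ℕ) : ℝ) * Real.exp ((A' - 1) * L ^ τ) := hexp
    _ < ((rad a b c : ℕ) : ℝ) * Real.exp (A' * L ^ τ) := mul_lt_mul_of_pos_left hlt hrad0

theorem abc_of_polyConstant : PolyConstantABC → _root_.ABC := by
  rintro ⟨κ, A, h⟩
  rw [_root_.ABC_iff]
  intro ε hε
  set ε' : ℝ := min ε 1 with hε'
  have hε'0 : 0 < ε' := lt_min hε one_pos
  have hε'1 : ε' ≤ 1 := min_le_right _ _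
  have hε'ε : ε' ≤ ε := min_le_left _ _
  refine ⟨Real.exp (A * ε' ^ (-κ)) + 1, by positivity, ?_⟩
  intro a b c habc
  have hrad1 : (1 : ℝ) ≤ ((rad a b c : ℕ) : ℝ) := by
    exact_mod_cast le_trans (by norm_num) (Summit.ABC.ABC.Theorems.SubmultOfRST.two_le_rad habc)
  have h1 := h ε' hε'0 hε'1 a b c habc
  have hpow : ((rad a b c : ℕ) : ℝ) ^ (1 + ε') ≤ ((rad a b c : ℕ) : ℝ) ^ (1 + ε) :=
    Real.rpow_le_rpow_of_exponent_le hrad1 (by linarith)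
  have hpos : 0 < ((rad a b c : ℕ) : ℝ) ^ (1 + ε) := Real.rpow_pos_of_pos (by linarith) _
  have hexp0 : 0 ≤ Real.exp (A * ε' ^ (-κ)) := (Real.exp_pos _).le
  calc (c : ℝ) ≤ Real.exp (A * ε' ^ (-κ)) * ((rad a b c : ℕ) : ℝ) ^ (1 + ε') := h1
    _ ≤ Real.exp (A * ε' ^ (-κ)) * ((rad a b c : ℕ) : ℝ) ^ (1 + ε) :=
        mul_le_mul_of_nonneg_left hpow hexp0
    _ < Real.exp (A * ε' ^ (-κ)) * ((rad a b c : ℕ) : ℝ) ^ (1 + ε) + ((rad a b c : ℕ) : ℝ) ^ (1 + ε) :=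
        lt_add_of_pos_right _ hpos
    _ = (Real.exp (A * ε' ^ (-κ)) + 1) * ((rad a b c : ℕ) : ℝ) ^ (1 + ε) := by ring

theorem sparseGoodScales_of_abc : _root_.ABC → SparseGoodScales := by
  intro hABC
  rw [_root_.ABC_iff] at hABC
  unfold SparseGoodScales
  intro δ hδ N
  obtain ⟨C, hC, h⟩ := hABC (δ / 2) (by linarith)
  have ht : Filter.Tendsto (fun R : ℕ => (R : ℝ) ^ (δ / 2)) Filter.atTop Filter.atTop :=
    (tendsto_rpow_atTop (by linarith)).comp tendsto_natCast_atTop_atTop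
  obtain ⟨R₀, hR₀⟩ := Filter.eventually_atTop.mp (ht.eventually_ge_atTop C)
  refine ⟨max (max N 1) R₀, le_trans (le_max_left _ _) (le_max_left _ _), ?_⟩
  intro a b c habc hrad
  have hR1n : 1 ≤ max (max N 1) R₀ := le_trans (le_max_right _ _) (le_max_left _ _)
  have hR1 : (1 : ℝ) ≤ ((max (max N 1) R₀ : ℕ) : ℝ) := by exact_mod_cast hR1n
  have hR0 : (0 : ℝ) < ((max (max N 1) R₀ : ℕ) : ℝ) := by linarith
  have hCR : C ≤ ((max (max N 1) R₀ : ℕ) : ℝ) ^ (δ / 2) := hR₀ _ (le_max_right _ _)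
  have hradR : ((rad a b c : ℕ) : ℝ) ≤ ((max (max N 1) R₀ : ℕ) : ℝ) := by exact_mod_cast hrad
  have hrad0 : (0 : ℝ) ≤ ((rad a b c : ℕ) : ℝ) := Nat.cast_nonneg _
  calc (c : ℝ) ≤ C * ((rad a b c : ℕ) : ℝ) ^ (1 + δ / 2) := (h a b c habc).le
    _ ≤ C * ((max (max N 1) R₀ : ℕ) : ℝ) ^ (1 + δ / 2) :=
        mul_le_mul_of_nonneg_left (Real.rpow_le_rpow hrad0 hradR (by linarith)) hC.le
    _ ≤ ((max (max N 1) R₀ : ℕ) : ℝ) ^ (δ / 2) * ((max (max N 1) R₀ : ℕ) : ℝ) ^ (1 + δ / 2) :=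
        mul_le_mul_of_nonneg_right hCR (Real.rpow_nonneg hR0.le _)
    _ = ((max (max N 1) R₀ : ℕ) : ℝ) ^ (1 + δ) := by
        rw [← Real.rpow_add hR0]; ring_nf

theorem scaleSubmultiplicativity_of_subPowerSlack : SubPowerSlack → ScaleSubmultiplicativity :=
  fun h => Summit.ABC.ABC.Theorems.submultOfRST_proof h

/-- **First lemma A.** abc with quasi-polynomial constant gives the crux `Target`. -/
theorem target_of_polyConstant : PolyConstantABC → Target := fun h =>
  Summit.ABC.ABC.Theorems.feketeScales_targetOfCruxes_proof
    (scaleSubmultiplicativity_of_subPowerSlack (subPowerSlack_of_polyConstant h))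
    (sparseGoodScales_of_abc (abc_of_polyConstant h))

/-- Real-variable core of the small-ω estimate: with `ε = L^{θ'-1}` (`L = log N ≥ 1`,
`w = ω(abc) ≤ L^{θ'}`), Baker's shape `log K + w log A + (1+ε)(L + w (1-θ') log L)` is at most
`L + M L^θ`, `M = |log K| + log A + 2 + 2/(θ - θ')`. [folklore] -/
theorem smallOmega_core {K A L w ε θ' θ lc : ℝ} (hA : 1 ≤ A) (hL1 : 1 ≤ L) (hw0 : 0 ≤ w)
    (hwL : w ≤ L ^ θ') (h0 : 0 < θ') (h1 : θ' < θ) (h2 : θ < 1) (hε : ε = L ^ (θ' - 1))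
    (hlc : lc ≤ Real.log K + w * Real.log A + (1 + ε) * (L + w * ((1 - θ') * Real.log L))) :
    lc ≤ L + (|Real.log K| + Real.log A + 2 + 2 / (θ - θ')) * L ^ θ := by
  have hL0 : 0 < L := by linarith
  have hθ'1 : θ' < 1 := h1.trans h2
  have hlogL : 0 ≤ Real.log L := Real.log_nonneg hL1
  have hlogA : 0 ≤ Real.log A := Real.log_nonneg hA
  have hgap : 0 < θ - θ' := by linarith
  have hε0 : 0 < ε := by rw [hε]; exact Real.rpow_pos_of_pos hL0 _
  have hε1 : ε ≤ 1 := by rw [hε]; exact Real.rpow_le_one_of_one_le_of_nonpos hL1 (by linarith)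
  have hLθ' : 0 ≤ L ^ θ' := Real.rpow_nonneg hL0.le _
  have hεL : ε * L = L ^ θ' := by
    rw [hε, show L ^ θ' = L ^ ((θ' - 1) + 1) by ring_nf, Real.rpow_add hL0, Real.rpow_one]
  have hLθ'θ : L ^ θ' ≤ L ^ θ := Real.rpow_le_rpow_of_exponent_le hL1 h1.le
  have h1Lθ : 1 ≤ L ^ θ := Real.one_le_rpow hL1 (by linarith)
  have hlogLb : L ^ θ' * Real.log L ≤ L ^ θ / (θ - θ') := by
    have hl : Real.log L ≤ L ^ (θ - θ') / (θ - θ') := Real.log_le_rpow_div hL0.le hgap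
    calc L ^ θ' * Real.log L ≤ L ^ θ' * (L ^ (θ - θ') / (θ - θ')) :=
          mul_le_mul_of_nonneg_left hl hLθ'
      _ = L ^ θ' * L ^ (θ - θ') / (θ - θ') := (mul_div_assoc _ _ _).symm
      _ = L ^ θ / (θ - θ') := by rw [← Real.rpow_add hL0]; ring_nf
  -- term-by-term bounds
  have T1 : Real.log K ≤ |Real.log K| * L ^ θ :=
    calc Real.log K ≤ |Real.log K| := le_abs_self _
      _ = |Real.log K| * 1 := (mul_one _).symm
      _ ≤ |Real.log K| * L ^ θ := mul_le_mul_of_nonneg_left h1Lθ (abs_nonneg _)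
  have T2 : w * Real.log A ≤ Real.log A * L ^ θ := by
    calc w * Real.log A ≤ L ^ θ * Real.log A :=
          mul_le_mul_of_nonneg_right (hwL.trans hLθ'θ) hlogA
      _ = Real.log A * L ^ θ := mul_comm _ _
  have T3 : (1 + ε) * L ≤ L + L ^ θ := by
    calc (1 + ε) * L = L + ε * L := by ring
      _ = L + L ^ θ' := by rw [hεL]
      _ ≤ L + L ^ θ := by linarith
  have hx : (1 - θ') * Real.log L ≤ Real.log L := by nlinarith
  have hx0 : 0 ≤ (1 - θ') * Real.log L := mul_nonneg (by linarith) hlogL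
  have hw' : (1 + ε) * w ≤ 2 * L ^ θ' := by nlinarith
  have T4 : (1 + ε) * w * ((1 - θ') * Real.log L) ≤ 2 / (θ - θ') * L ^ θ := by
    calc (1 + ε) * w * ((1 - θ') * Real.log L) ≤ 2 * L ^ θ' * ((1 - θ') * Real.log L) :=
          mul_le_mul_of_nonneg_right hw' hx0
      _ ≤ 2 * L ^ θ' * Real.log L := mul_le_mul_of_nonneg_left hx (by positivity)
      _ = 2 * (L ^ θ' * Real.log L) := by ring
      _ ≤ 2 * (L ^ θ / (θ - θ')) := by linarith [hlogLb]
      _ = 2 / (θ - θ') * L ^ θ := by ring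
  have e : Real.log K + w * Real.log A + (1 + ε) * (L + w * ((1 - θ') * Real.log L))
      = Real.log K + w * Real.log A + (1 + ε) * L + (1 + ε) * w * ((1 - θ') * Real.log L) := by
    ring
  rw [e] at hlc
  have hsum : |Real.log K| * L ^ θ + Real.log A * L ^ θ + L ^ θ + 2 / (θ - θ') * L ^ θ
      ≤ (|Real.log K| + Real.log A + 2 + 2 / (θ - θ')) * L ^ θ := by
    nlinarith [h1Lθ]
  linarith

theorem subPowerSlack_of_omegaSplit {θ' θ : ℝ} (h0 : 0 < θ') (h1 : θ' < θ) (h2 : θ < 1) :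
    SmallOmegaBaker θ' → LargeOmegaSubPower θ' θ → SubPowerSlack := by
  rintro ⟨K, A, hK, hA, hS⟩ ⟨AL, hL⟩
  have hθ0 : 0 < θ := h0.trans h1
  have hgap : 0 < θ - θ' := by linarith
  have hlog2 : 0 < Real.log 2 := Real.log_pos one_lt_two
  have hl2θ : 0 < Real.log 2 ^ θ := Real.rpow_pos_of_pos hlog2 _
  -- constants of the small-ω regime
  set M : ℝ := |Real.log K| + Real.log A + 2 + 2 / (θ - θ') with hM
  have hlogA : 0 ≤ Real.log A := Real.log_nonneg hA
  have hM0 : 0 ≤ M := by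
    have : 0 ≤ 2 / (θ - θ') := div_nonneg (by norm_num) hgap.le
    rw [hM]; positivity
  set AS : ℝ := M / Real.log 2 ^ θ + M + 1 with hAS
  have hMl : 0 ≤ M / Real.log 2 ^ θ := div_nonneg hM0 hl2θ.le
  refine ⟨θ, h2, max AS AL, ?_⟩
  intro a b c habc
  have hc0 : (0 : ℝ) < (c : ℝ) := by
    obtain ⟨ha, hb, habc', -⟩ := habc; exact_mod_cast (show 0 < c by omega)
  have hrad2 : (2 : ℝ) ≤ ((rad a b c : ℕ) : ℝ) := by
    exact_mod_cast Summit.ABC.ABC.Theorems.SubmultOfRST.two_le_rad habc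
  have hrad0 : (0 : ℝ) < ((rad a b c : ℕ) : ℝ) := by linarith
  set L : ℝ := Real.log ((rad a b c : ℕ) : ℝ) with hLdef
  have hL2 : Real.log 2 ≤ L := Real.log_le_log two_pos hrad2
  have hL0 : 0 < L := hlog2.trans_le hL2
  have hLθ0 : 0 ≤ L ^ θ := Real.rpow_nonneg hL0.le _
  have hLθ2 : Real.log 2 ^ θ ≤ L ^ θ := Real.rpow_le_rpow hlog2.le hL2 hθ0.le
  have hmax : ((rad a b c : ℕ) : ℝ) * Real.exp (AS * L ^ θ)
      ≤ ((rad a b c : ℕ) : ℝ) * Real.exp (max AS AL * L ^ θ) :=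
    mul_le_mul_of_nonneg_left
      (Real.exp_le_exp.mpr (mul_le_mul_of_nonneg_right (le_max_left _ _) hLθ0)) hrad0.le
  set w : ℕ := ArithmeticFunction.cardDistinctFactors (a * b * c) with hw
  rcases le_or_gt (w : ℝ) (L ^ θ') with hsmall | hlarge
  swap
  · -- LARGE ω: the stub applies verbatim
    calc (c : ℝ) < ((rad a b c : ℕ) : ℝ) * Real.exp (AL * L ^ θ) := hL a b c habc hlarge
      _ ≤ ((rad a b c : ℕ) : ℝ) * Real.exp (max AS AL * L ^ θ) :=
          mul_le_mul_of_nonneg_left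
            (Real.exp_le_exp.mpr (mul_le_mul_of_nonneg_right (le_max_right _ _) hLθ0)) hrad0.le
  · -- SMALL ω: Baker's shape with the Legendre-optimal `ε`
    have hsmall' : (w : ℝ) ≤ Real.log ((rad a b c : ℕ) : ℝ) ^ θ' := hsmall
    -- it suffices to get `log c < L + AS L^θ`
    suffices hlt : Real.log (c : ℝ) < L + AS * L ^ θ by
      calc (c : ℝ) = Real.exp (Real.log (c : ℝ)) := (Real.exp_log hc0).symm
        _ < Real.exp (L + AS * L ^ θ) := Real.exp_lt_exp.mpr hlt
        _ = ((rad a b c : ℕ) : ℝ) * Real.exp (AS * L ^ θ) := by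
            rw [Real.exp_add, hLdef, Real.exp_log hrad0]
        _ ≤ ((rad a b c : ℕ) : ℝ) * Real.exp (max AS AL * L ^ θ) := hmax
    rcases le_or_gt 1 L with hL1 | hL1
    · -- `L ≥ 1`, `ε := L^{θ'-1}`
      set ε : ℝ := L ^ (θ' - 1) with hε
      have hε0 : 0 < ε := Real.rpow_pos_of_pos hL0 _
      have hε1 : ε ≤ 1 := Real.rpow_le_one_of_one_le_of_nonpos hL1 (by linarith)
      have hsm := hS ε hε0 hε1 a b c habc hsmall'
      -- positivity of the pieces of Baker's bound
      have hA0 : 0 < A := by linarith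
      have hAw : 0 < A ^ w := pow_pos hA0 w
      have hεw : 0 < ε ^ (-(w : ℝ)) := Real.rpow_pos_of_pos hε0 _
      have hbase : 0 < ((rad a b c : ℕ) : ℝ) * ε ^ (-(w : ℝ)) := mul_pos hrad0 hεw
      have hX : 0 < (((rad a b c : ℕ) : ℝ) * ε ^ (-(w : ℝ))) ^ (1 + ε) := Real.rpow_pos_of_pos hbase _
      have hlogc : Real.log (c : ℝ)
          ≤ Real.log (K * A ^ w * (((rad a b c : ℕ) : ℝ) * ε ^ (-(w : ℝ))) ^ (1 + ε)) :=
        Real.log_le_log hc0 hsm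
      have hlogε : Real.log ε = (θ' - 1) * L.log := by rw [hε, Real.log_rpow hL0]
      have e1 : Real.log (K * A ^ w * (((rad a b c : ℕ) : ℝ) * ε ^ (-(w : ℝ))) ^ (1 + ε))
          = Real.log K + (w : ℝ) * Real.log A + (1 + ε) * (L + (w : ℝ) * ((1 - θ') * Real.log L)) := by
        rw [Real.log_mul (mul_pos hK hAw).ne' hX.ne', Real.log_mul hK.ne' hAw.ne', Real.log_pow,
          Real.log_rpow hbase, Real.log_mul hrad0.ne' hεw.ne', Real.log_rpow hε0, hlogε]
        ring
      rw [e1] at hlogc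
      have core := smallOmega_core hA hL1 (Nat.cast_nonneg w) hsmall' h0 h1 h2 hε hlogc
      have hstrict : M * L ^ θ < AS * L ^ θ := by
        apply mul_lt_mul_of_pos_right _ (Real.rpow_pos_of_pos hL0 _)
        rw [hAS]; linarith
      calc Real.log (c : ℝ) ≤ L + M * L ^ θ := core
        _ < L + AS * L ^ θ := by linarith
    · -- `L < 1`: then `w = 0` and `ε := 1`
      have hLθ'1 : L ^ θ' < 1 := Real.rpow_lt_one hL0.le hL1 h0
      have hw1 : (w : ℝ) < 1 := hsmall'.trans_lt hLθ'1
      have hw0 : w = 0 := by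
        have : w < 1 := by exact_mod_cast hw1
        omega
      have hsm := hS 1 one_pos le_rfl a b c habc hsmall'
      rw [Real.one_rpow, mul_one] at hsm
      have hKw : K * A ^ w = K := by rw [hw0, pow_zero, mul_one]
      rw [hKw] at hsm
      have hX : 0 < ((rad a b c : ℕ) : ℝ) ^ (1 + (1 : ℝ)) := Real.rpow_pos_of_pos hrad0 _
      have hlogc : Real.log (c : ℝ) ≤ Real.log K + (1 + 1) * L := by
        have := Real.log_le_log hc0 hsm
        rwa [Real.log_mul hK.ne' hX.ne', Real.log_rpow hrad0] at this
      have hK1 : Real.log K ≤ |Real.log K| := le_abs_self _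
      have hMK : |Real.log K| + 1 ≤ M := by
        rw [hM]
        have : 0 ≤ 2 / (θ - θ') := div_nonneg (by norm_num) hgap.le
        linarith
      have hMAS : M ≤ AS * L ^ θ := by
        have h3 : M ≤ M / Real.log 2 ^ θ * L ^ θ := by
          rw [div_mul_eq_mul_div, le_div_iff₀ hl2θ]
          exact mul_le_mul_of_nonneg_left hLθ2 hM0
        have h4 : M / Real.log 2 ^ θ * L ^ θ ≤ AS * L ^ θ := by
          apply mul_le_mul_of_nonneg_right _ hLθ0
          rw [hAS]; linarith
        linarith
      linarith

theorem abc_of_subPowerSlack : SubPowerSlack → _root_.ABC := by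
  rintro ⟨τ, hτ1, A, h⟩
  rw [_root_.ABC_iff]
  intro ε hε
  -- `A (log rad)^τ ≤ B (log rad)^t` with `t = max τ 0 < 1`, then `B (log P)^t ≤ ε log P` for `P ≥ N₀`
  set t : ℝ := max τ 0 with ht_def
  have ht0 : 0 ≤ t := le_max_right _ _
  have ht1 : t < 1 := max_lt hτ1 one_pos
  set B : ℝ := |A| * max 1 (Real.log 2 ^ τ) with hB_def
  have hB0 : 0 ≤ B := mul_nonneg (abs_nonneg A) (le_trans zero_le_one (le_max_left _ _))
  have hs : 0 < 1 - t := by linarith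
  obtain ⟨N₀, hN₀⟩ := Summit.ABC.ABC.Theorems.SubmultOfRST.exists_threshold (B / ε) hs
  -- constant: covers the finitely many scales below `N₀` crudely via `c < rad · exp(B (log N₀)^t)`
  -- (all triples with `rad < N₀`), and `C = 1` works above `N₀`; take the max.
  refine ⟨Real.exp (B * Real.log (N₀ : ℝ) ^ t) + 1, by positivity, ?_⟩
  intro a b c habc
  have hrad2 : (2 : ℝ) ≤ ((rad a b c : ℕ) : ℝ) := by
    exact_mod_cast Summit.ABC.ABC.Theorems.SubmultOfRST.two_le_rad habc
  have hrad0 : (0 : ℝ) < ((rad a b c : ℕ) : ℝ) := by linarith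
  have hrad1 : (1 : ℝ) ≤ ((rad a b c : ℕ) : ℝ) := by linarith
  have hlog0 : 0 ≤ Real.log ((rad a b c : ℕ) : ℝ) := Real.log_nonneg hrad1
  have hc := h a b c habc
  have hpow1 : ((rad a b c : ℕ) : ℝ) ≤ ((rad a b c : ℕ) : ℝ) ^ (1 + ε) := by
    calc ((rad a b c : ℕ) : ℝ) = ((rad a b c : ℕ) : ℝ) ^ (1 : ℝ) := (Real.rpow_one _).symm
      _ ≤ ((rad a b c : ℕ) : ℝ) ^ (1 + ε) := Real.rpow_le_rpow_of_exponent_le hrad1 (by linarith)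
  have hpowpos : 0 < ((rad a b c : ℕ) : ℝ) ^ (1 + ε) := Real.rpow_pos_of_pos hrad0 _
  rcases le_or_gt N₀ (rad a b c) with hN | hN
  · -- large radical: `A (log rad)^τ ≤ B (log rad)^t ≤ ε log rad`, so `c < rad^{1+ε}`
    have hslack : A * Real.log ((rad a b c : ℕ) : ℝ) ^ τ ≤ B * Real.log ((rad a b c : ℕ) : ℝ) ^ t :=
      Summit.ABC.ABC.Theorems.SubmultOfRST.slack_le habc le_rfl
    have hthr : B / ε ≤ Real.log ((rad a b c : ℕ) : ℝ) ^ (1 - t) := hN₀ _ hN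
    have hBt : B * Real.log ((rad a b c : ℕ) : ℝ) ^ t ≤ ε * Real.log ((rad a b c : ℕ) : ℝ) := by
      have e1 : ε * Real.log ((rad a b c : ℕ) : ℝ)
          = ε * Real.log ((rad a b c : ℕ) : ℝ) ^ (1 - t) * Real.log ((rad a b c : ℕ) : ℝ) ^ t := by
        rw [mul_assoc, ← Real.rpow_add_of_nonneg hlog0 hs.le ht0]; norm_num
      rw [e1]
      apply mul_le_mul_of_nonneg_right _ (Real.rpow_nonneg hlog0 _)
      rwa [div_le_iff₀ hε, mul_comm] at hthr
    have hexp : Real.exp (A * Real.log ((rad a b c : ℕ) : ℝ) ^ τ) ≤ ((rad a b c : ℕ) : ℝ) ^ ε := by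
      calc Real.exp (A * Real.log ((rad a b c : ℕ) : ℝ) ^ τ)
            ≤ Real.exp (ε * Real.log ((rad a b c : ℕ) : ℝ)) := Real.exp_le_exp.mpr (hslack.trans hBt)
        _ = ((rad a b c : ℕ) : ℝ) ^ ε := by
            rw [Real.rpow_def_of_pos hrad0, mul_comm]
    calc (c : ℝ) < ((rad a b c : ℕ) : ℝ) * Real.exp (A * Real.log ((rad a b c : ℕ) : ℝ) ^ τ) := hc
      _ ≤ ((rad a b c : ℕ) : ℝ) * ((rad a b c : ℕ) : ℝ) ^ ε := mul_le_mul_of_nonneg_left hexp hrad0.le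
      _ = ((rad a b c : ℕ) : ℝ) ^ (1 + ε) := by
          rw [Real.rpow_add hrad0, Real.rpow_one]
      _ = 1 * ((rad a b c : ℕ) : ℝ) ^ (1 + ε) := (one_mul _).symm
      _ < (Real.exp (B * Real.log (N₀ : ℝ) ^ t) + 1) * ((rad a b c : ℕ) : ℝ) ^ (1 + ε) := by
          apply mul_lt_mul_of_pos_right _ hpowpos
          linarith [Real.exp_pos (B * Real.log (N₀ : ℝ) ^ t)]
  · -- small radical `rad < N₀`: `A (log rad)^τ ≤ B (log N₀)^t`
    have hslack : A * Real.log ((rad a b c : ℕ) : ℝ) ^ τ ≤ B * Real.log (N₀ : ℝ) ^ t :=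
      Summit.ABC.ABC.Theorems.SubmultOfRST.slack_le habc hN.le
    calc (c : ℝ) < ((rad a b c : ℕ) : ℝ) * Real.exp (A * Real.log ((rad a b c : ℕ) : ℝ) ^ τ) := hc
      _ ≤ ((rad a b c : ℕ) : ℝ) ^ (1 + ε) * Real.exp (B * Real.log (N₀ : ℝ) ^ t) :=
          mul_le_mul hpow1 (Real.exp_le_exp.mpr hslack) (Real.exp_pos _).le (Real.rpow_nonneg hrad0.le _)
      _ < ((rad a b c : ℕ) : ℝ) ^ (1 + ε) * Real.exp (B * Real.log (N₀ : ℝ) ^ t) + ((rad a b c : ℕ) : ℝ) ^ (1 + ε) :=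
          lt_add_of_pos_right _ hpowpos
      _ = (Real.exp (B * Real.log (N₀ : ℝ) ^ t) + 1) * ((rad a b c : ℕ) : ℝ) ^ (1 + ε) := by ring

/-- **First lemma B.** The ω-split: the two regime stubs give the crux `Target`. -/
theorem target_of_omegaSplit {θ' θ : ℝ} (h0 : 0 < θ') (h1 : θ' < θ) (h2 : θ < 1)
    (hS : SmallOmegaBaker θ') (hL : LargeOmegaSubPower θ' θ) : Target :=
  Summit.ABC.ABC.Theorems.feketeScales_targetOfCruxes_proof
    (scaleSubmultiplicativity_of_subPowerSlack (subPowerSlack_of_omegaSplit h0 h1 h2 hS hL))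
    (sparseGoodScales_of_abc (abc_of_subPowerSlack (subPowerSlack_of_omegaSplit h0 h1 h2 hS hL)))

/-! ### Where the stubs come from: RST Conjecture A (upper half) and Baker's shape

`polyConstant_of_RST`: Robert–Stewart–Tenenbaum's Conjecture A (upper half, the tree's open conjecture
`Literature.Barriers.ABC.RSTConjectureAUpper`) gives `PolyConstantABC` with `κ = 1`
(`C(ε) = exp(M²/(4ε))`), hence `Target`.  `smallOmegaBaker_of_bakerShape`: route LogCardinality's
target (`∃ κ, BakerShapeExplicitABC κ`, Baker's refinement `c < κ N (log N)^ω/ω!`) gives the small-ω stub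
for EVERY `θ'`, through the elementary `(log N)^ω/ω! ≤ N^ε ε^{-ω}` (`0 < ε ≤ 1`). -/

/-- RST Conjecture A (upper half) ⟹ abc with the quasi-polynomial constant `exp(M²/4 · ε⁻¹)`,
`M = 4√3 (3/2 + |C₁|)`. [cite: RobertStewartTenenbaum2014, §1, remark following Conjecture A] -/
theorem polyConstant_of_RST (h : Literature.Barriers.ABC.RSTConjectureAUpper) : PolyConstantABC := by
  obtain ⟨C₁, hC₁⟩ := h
  set M : ℝ := 4 * Real.sqrt 3 * (3 / 2 + |C₁|) with hM
  refine ⟨1, M ^ 2 / 4, ?_⟩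
  intro ε hε _hε1 a b c habc
  have hlt := hC₁ a b c habc
  have hrad2 : (2 : ℝ) ≤ ((rad a b c : ℕ) : ℝ) := by
    exact_mod_cast Summit.ABC.ABC.Theorems.SubmultOfRST.two_le_rad habc
  have hk1 : (1 : ℝ) ≤ ((rad a b c : ℕ) : ℝ) := by linarith
  have hkpos : (0 : ℝ) < ((rad a b c : ℕ) : ℝ) := by linarith
  have hlog : 0 ≤ Real.log ((rad a b c : ℕ) : ℝ) := Real.log_nonneg hk1
  have h1 : Literature.Barriers.ABC.rstExponent C₁ ((rad a b c : ℕ) : ℝ)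
      ≤ M * Real.sqrt (Real.log ((rad a b c : ℕ) : ℝ)) :=
    Literature.Barriers.ABC.rstExponent_le C₁ hk1
  have h2 : M * Real.sqrt (Real.log ((rad a b c : ℕ) : ℝ))
      ≤ ε * Real.log ((rad a b c : ℕ) : ℝ) + M ^ 2 / (4 * ε) := by
    have := Literature.Barriers.ABC.mul_le_eps_mul_sq_add M
      (Real.sqrt (Real.log ((rad a b c : ℕ) : ℝ))) hε
    rwa [Real.sq_sqrt hlog] at this
  have hexpε : M ^ 2 / 4 * ε ^ (-(1 : ℝ)) = M ^ 2 / (4 * ε) := by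
    rw [Real.rpow_neg_one]; field_simp
  calc (c : ℝ) ≤ ((rad a b c : ℕ) : ℝ) *
        Real.exp (Literature.Barriers.ABC.rstExponent C₁ ((rad a b c : ℕ) : ℝ)) := hlt.le
    _ ≤ ((rad a b c : ℕ) : ℝ) *
        Real.exp (ε * Real.log ((rad a b c : ℕ) : ℝ) + M ^ 2 / (4 * ε)) := by
        gcongr
        exact h1.trans h2
    _ = Real.exp (M ^ 2 / 4 * ε ^ (-(1 : ℝ))) * ((rad a b c : ℕ) : ℝ) ^ (1 + ε) := by
        rw [hexpε, Real.rpow_add hkpos, Real.rpow_one, Real.rpow_def_of_pos hkpos, Real.exp_add,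
          mul_comm (Real.log _) ε]
        ring

/-- RST Conjecture A (upper half) ⟹ the crux `Target`. -/
theorem target_of_RST (h : Literature.Barriers.ABC.RSTConjectureAUpper) : Target :=
  target_of_polyConstant (polyConstant_of_RST h)

/-- The elementary inequality behind "Baker's two shapes agree": for `L ≥ 0`, `0 < ε ≤ 1` and
`ω : ℕ`, `L^ω / ω! ≤ e^{εL} · ε^{-ω}`. [folklore] -/
theorem pow_div_factorial_le_exp_mul_rpow {L ε : ℝ} (hL : 0 ≤ L) (hε : 0 < ε) (ω : ℕ) :
    L ^ ω / (Nat.factorial ω : ℝ) ≤ Real.exp (ε * L) * ε ^ (-(ω : ℝ)) := by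
  have h := Real.pow_div_factorial_le_exp (ε * L) (by positivity) ω
  rw [mul_pow] at h
  have hεω : (0 : ℝ) < ε ^ ω := pow_pos hε ω
  rw [Real.rpow_neg hε.le, Real.rpow_natCast]
  rw [div_le_iff₀ (by positivity)] at h
  rw [div_le_iff₀ (by positivity : (0 : ℝ) < (Nat.factorial ω : ℝ))]
  calc L ^ ω = ε ^ ω * L ^ ω * (ε ^ ω)⁻¹ := by field_simp
    _ ≤ Real.exp (ε * L) * (Nat.factorial ω : ℝ) * (ε ^ ω)⁻¹ :=
        mul_le_mul_of_nonneg_right h (inv_nonneg.mpr hεω.le)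
    _ = Real.exp (ε * L) * (ε ^ ω)⁻¹ * (Nat.factorial ω : ℝ) := by ring

/-- Route LogCardinality's target (Baker's refinement with SOME constant) ⟹ the small-ω stub for
every `θ'` (indeed Baker's Conjecture 12.2.6 shape for ALL triples, with `K = max κ 1`, `A = 1`).
[cite: BombieriGubler2006, Conj. 12.2.6] -/
theorem smallOmegaBaker_of_bakerShape (h : ∃ κ : ℝ, Literature.Barriers.ABC.BakerShapeExplicitABC κ)
    (θ' : ℝ) : SmallOmegaBaker θ' := by
  obtain ⟨κ, hκ⟩ := h
  refine ⟨max κ 1, 1, by positivity, le_rfl, ?_⟩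
  intro ε hε hε1 a b c habc _hω
  rw [one_pow, mul_one]
  have hrad2 : (2 : ℝ) ≤ ((rad a b c : ℕ) : ℝ) := by
    exact_mod_cast Summit.ABC.ABC.Theorems.SubmultOfRST.two_le_rad habc
  have hk1 : (1 : ℝ) ≤ ((rad a b c : ℕ) : ℝ) := by linarith
  have hkpos : (0 : ℝ) < ((rad a b c : ℕ) : ℝ) := by linarith
  have hlog : 0 ≤ Real.log ((rad a b c : ℕ) : ℝ) := Real.log_nonneg hk1
  set w : ℕ := ArithmeticFunction.cardDistinctFactors (a * b * c) with hw
  have hεw1 : 1 ≤ ε ^ (-(w : ℝ)) := by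
    apply Real.one_le_rpow_of_pos_of_le_one_of_nonpos hε hε1
    simp
  -- the right-hand side dominates `max κ 1 · rad^{1+ε} · ε^{-w}` and `rad`
  have hbase1 : (1 : ℝ) ≤ ((rad a b c : ℕ) : ℝ) * ε ^ (-(w : ℝ)) := by nlinarith
  have hbase0 : (0 : ℝ) ≤ ((rad a b c : ℕ) : ℝ) * ε ^ (-(w : ℝ)) := by linarith
  have hR : ((rad a b c : ℕ) : ℝ) ^ (1 + ε) * ε ^ (-(w : ℝ))
      ≤ (((rad a b c : ℕ) : ℝ) * ε ^ (-(w : ℝ))) ^ (1 + ε) := by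
    rw [Real.mul_rpow hkpos.le (by linarith)]
    apply mul_le_mul_of_nonneg_left _ (Real.rpow_nonneg hkpos.le _)
    calc ε ^ (-(w : ℝ)) = (ε ^ (-(w : ℝ))) ^ (1 : ℝ) := (Real.rpow_one _).symm
      _ ≤ (ε ^ (-(w : ℝ))) ^ (1 + ε) := Real.rpow_le_rpow_of_exponent_le hεw1 (by linarith)
  have hK : κ ≤ max κ 1 := le_max_left _ _
  have hK1 : (1 : ℝ) ≤ max κ 1 := le_max_right _ _
  -- Baker's shape ⟹ the `ε`-shape, for a triple `(x, y, c)` with `x < y`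
  have key : ∀ x y : ℕ, IsABCTriple x y c → x < y → rad x y c = rad a b c →
      ArithmeticFunction.cardDistinctFactors (x * y * c) = w →
      (c : ℝ) ≤ max κ 1 * (((rad a b c : ℕ) : ℝ) * ε ^ (-(w : ℝ))) ^ (1 + ε) := by
    intro x y hxy hlt hradxy hwxy
    have hB := hκ x y c hxy hlt
    rw [hradxy, hwxy] at hB
    have hpf := pow_div_factorial_le_exp_mul_rpow hlog hε w
    have hexp : Real.exp (ε * Real.log ((rad a b c : ℕ) : ℝ)) = ((rad a b c : ℕ) : ℝ) ^ ε := by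
      rw [Real.rpow_def_of_pos hkpos, mul_comm]
    rw [hexp] at hpf
    have hκ0 : 0 ≤ κ := by
      -- `κ > 0` is forced by `0 < c < κ · (positive)`; we only need `0 ≤ κ`
      by_contra hneg
      rw [not_le] at hneg
      have hpos : 0 ≤ ((rad a b c : ℕ) : ℝ) * Real.log ((rad a b c : ℕ) : ℝ) ^ w / (Nat.factorial w : ℝ) := by
        positivity
      have : (c : ℝ) < 0 := by
        calc (c : ℝ) < κ * ((rad a b c : ℕ) : ℝ) * Real.log ((rad a b c : ℕ) : ℝ) ^ w / (Nat.factorial w : ℝ) := hB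
          _ = κ * (((rad a b c : ℕ) : ℝ) * Real.log ((rad a b c : ℕ) : ℝ) ^ w / (Nat.factorial w : ℝ)) := by ring
          _ ≤ 0 := mul_nonpos_of_nonpos_of_nonneg hneg.le hpos
      linarith [Nat.cast_nonneg (α := ℝ) c]
    calc (c : ℝ) ≤ κ * ((rad a b c : ℕ) : ℝ) * Real.log ((rad a b c : ℕ) : ℝ) ^ w / (Nat.factorial w : ℝ) := hB.le
      _ = κ * ((rad a b c : ℕ) : ℝ) * (Real.log ((rad a b c : ℕ) : ℝ) ^ w / (Nat.factorial w : ℝ)) := by ring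
      _ ≤ κ * ((rad a b c : ℕ) : ℝ) * (((rad a b c : ℕ) : ℝ) ^ ε * ε ^ (-(w : ℝ))) :=
          mul_le_mul_of_nonneg_left hpf (by positivity)
      _ = κ * (((rad a b c : ℕ) : ℝ) ^ (1 + ε) * ε ^ (-(w : ℝ))) := by
          rw [Real.rpow_add hkpos, Real.rpow_one]; ring
      _ ≤ max κ 1 * (((rad a b c : ℕ) : ℝ) ^ (1 + ε) * ε ^ (-(w : ℝ))) :=
          mul_le_mul_of_nonneg_right hK (by positivity)
      _ ≤ max κ 1 * (((rad a b c : ℕ) : ℝ) * ε ^ (-(w : ℝ))) ^ (1 + ε) :=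
          mul_le_mul_of_nonneg_left hR (by linarith)
  obtain ⟨ha, hb, habc', hcop⟩ := habc
  rcases lt_trichotomy a b with hlt | heq | hgt
  · exact key a b ⟨ha, hb, habc', hcop⟩ hlt rfl rfl
  · -- `a = b`: then `a = b = 1`, `c = 2 ≤ rad ≤ RHS`
    subst heq
    have ha1 : a = 1 := (Nat.coprime_self a).mp hcop
    subst ha1
    have hc2 : (c : ℝ) = 2 := by
      have : c = 2 := by omega
      exact_mod_cast this
    calc (c : ℝ) = 2 := hc2
      _ ≤ ((rad 1 1 c : ℕ) : ℝ) := hrad2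
      _ ≤ ((rad 1 1 c : ℕ) : ℝ) * ε ^ (-(w : ℝ)) := le_mul_of_one_le_right hkpos.le hεw1
      _ = (((rad 1 1 c : ℕ) : ℝ) * ε ^ (-(w : ℝ))) ^ (1 : ℝ) := (Real.rpow_one _).symm
      _ ≤ (((rad 1 1 c : ℕ) : ℝ) * ε ^ (-(w : ℝ))) ^ (1 + ε) :=
          Real.rpow_le_rpow_of_exponent_le hbase1 (by linarith)
      _ = 1 * (((rad 1 1 c : ℕ) : ℝ) * ε ^ (-(w : ℝ))) ^ (1 + ε) := (one_mul _).symm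
      _ ≤ max κ 1 * (((rad 1 1 c : ℕ) : ℝ) * ε ^ (-(w : ℝ))) ^ (1 + ε) :=
          mul_le_mul_of_nonneg_right hK1 (Real.rpow_nonneg hbase0 _)
  · -- `b < a`: apply Baker's shape to the swapped triple `(b, a, c)`
    have hsym : IsABCTriple b a c := ⟨hb, ha, by omega, hcop.symm⟩
    have hradsym : rad b a c = rad a b c := by rw [rad_def, rad_def, mul_comm b a]
    have hwsym : ArithmeticFunction.cardDistinctFactors (b * a * c) = w := by rw [hw, mul_comm b a]
    exact key b a hsym hgt hradsym hwsym

/-! ### Calibration from below: the exponent window of the line is `τ ∈ [1/2, 1)`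

Stewart–Tijdeman (`Literature.Barriers.ABC.EpsilonCannotBeDropped`, PROVED in the tree as
`EpsilonCannotBeDropped_holds`) refutes every sub-power slack with exponent `τ < 1/2`, i.e. (by the
Legendre duality of `subPowerSlack_of_polyConstant`) every quasi-polynomial constant with `κ < 1`. -/

/-- Growth comparison: for `τ < 1/2`, eventually `A (log k)^τ ≤ 2 √(log k) / log log k`. [folklore] -/
theorem eventually_slack_le_ST {τ : ℝ} (hτ : τ < 1 / 2) (A : ℝ) :
    ∃ K : ℕ, ∀ k : ℕ, K ≤ k →
      A * Real.log (k : ℝ) ^ τ ≤ 2 * Real.sqrt (Real.log (k : ℝ)) / Real.log (Real.log (k : ℝ)) := by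
  set s : ℝ := (1 / 2 - τ) / 2 with hs
  have hs0 : 0 < s := by rw [hs]; linarith
  -- threshold in `L = log k`
  set L₀ : ℝ := (|A| / (2 * s)) ^ (1 / s) with hL₀
  have hL₀0 : 0 ≤ L₀ := Real.rpow_nonneg (div_nonneg (abs_nonneg A) (by positivity)) _
  set Lm : ℝ := max L₀ (Real.exp 1) with hLm
  refine ⟨⌈Real.exp Lm⌉₊, fun k hk => ?_⟩
  have hk1 : Real.exp Lm ≤ (k : ℝ) := (Nat.le_ceil _).trans (by exact_mod_cast hk)
  have hk0 : (0 : ℝ) < k := (Real.exp_pos _).trans_le hk1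
  set L : ℝ := Real.log (k : ℝ) with hL
  have hLm_le : Lm ≤ L := by rw [hL, Real.le_log_iff_exp_le hk0]; exact hk1
  have hLe : Real.exp 1 ≤ L := (le_max_right _ _).trans hLm_le
  have hL1 : 1 < L := lt_of_lt_of_le (by linarith [Real.add_one_lt_exp (one_ne_zero)]) hLe
  have hL0 : 0 < L := by linarith
  have hlogL1 : 1 ≤ Real.log L := by
    rw [Real.le_log_iff_exp_le hL0]; exact hLe
  have hlogL0 : 0 < Real.log L := by linarith
  -- `|A| L^τ log L ≤ 2 √L`
  have key : |A| * L ^ τ * Real.log L ≤ 2 * Real.sqrt L := by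
    have hlog : Real.log L ≤ L ^ s / s := Real.log_le_rpow_div hL0.le hs0
    have hLs : |A| / (2 * s) ≤ L ^ s := by
      have h1 : L₀ ≤ L := (le_max_left _ _).trans hLm_le
      calc |A| / (2 * s) = L₀ ^ s := by
            rw [hL₀, one_div, Real.rpow_inv_rpow (div_nonneg (abs_nonneg A) (by positivity)) hs0.ne']
        _ ≤ L ^ s := Real.rpow_le_rpow hL₀0 h1 hs0.le
    have hLτ : 0 ≤ L ^ τ := Real.rpow_nonneg hL0.le _
    have hsqrt : Real.sqrt L = L ^ (τ + s) * L ^ s := by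
      rw [Real.sqrt_eq_rpow, ← Real.rpow_add hL0]; congr 1; rw [hs]; ring
    calc |A| * L ^ τ * Real.log L ≤ |A| * L ^ τ * (L ^ s / s) :=
          mul_le_mul_of_nonneg_left hlog (mul_nonneg (abs_nonneg A) hLτ)
      _ = (|A| / (2 * s)) * (L ^ τ * L ^ s) * 2 := by field_simp
      _ ≤ L ^ s * (L ^ τ * L ^ s) * 2 :=
          mul_le_mul_of_nonneg_right (mul_le_mul_of_nonneg_right hLs (by positivity)) (by norm_num)
      _ = 2 * (L ^ (τ + s) * L ^ s) := by rw [Real.rpow_add hL0]; ring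
      _ = 2 * Real.sqrt L := by rw [hsqrt]
  have hA : A * L ^ τ * Real.log L ≤ 2 * Real.sqrt L :=
    le_trans (mul_le_mul_of_nonneg_right
      (mul_le_mul_of_nonneg_right (le_abs_self A) (Real.rpow_nonneg hL0.le _)) hlogL0.le) key
  rw [le_div_iff₀ hlogL0]
  exact hA

/-- **Exponent floor.** No sub-power slack with exponent `τ < 1/2` holds for all abc triples
(Stewart–Tijdeman's families beat it); equivalently `PolyConstantABC` needs `κ ≥ 1`. -/
theorem not_subPowerSlack_of_lt_half {τ : ℝ} (hτ : τ < 1 / 2) (A : ℝ) :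
    ¬ ∀ a b c : ℕ, IsABCTriple a b c →
      (c : ℝ) < ((rad a b c : ℕ) : ℝ) * Real.exp (A * Real.log ((rad a b c : ℕ) : ℝ) ^ τ) := by
  intro hall
  obtain ⟨K, hK⟩ := eventually_slack_le_ST hτ A
  have hST := Literature.Barriers.ABC.EpsilonCannotBeDropped_holds 2 two_pos
  have hinf := Literature.Barriers.ABC.infinite_lowerFamily_mono
    (G₁ := fun k : ℕ => (k : ℝ) * Real.exp ((4 - 2) * Real.sqrt (Real.log (k : ℝ)) / Real.log (Real.log (k : ℝ))))
    (G₂ := fun k : ℕ => (k : ℝ) * Real.exp (A * Real.log (k : ℝ) ^ τ)) K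
    (fun k hk => by
      have h := hK k hk
      apply mul_le_mul_of_nonneg_left _ (Nat.cast_nonneg k)
      apply Real.exp_le_exp.mpr
      calc A * Real.log (k : ℝ) ^ τ ≤ 2 * Real.sqrt (Real.log (k : ℝ)) / Real.log (Real.log (k : ℝ)) := h
        _ = (4 - 2) * Real.sqrt (Real.log (k : ℝ)) / Real.log (Real.log (k : ℝ)) := by norm_num)
    hST
  obtain ⟨⟨a, b, c⟩, habc, hlt⟩ := hinf.nonempty
  exact lt_asymm hlt (hall a b c habc)

end Summit.ABC.ABC.Cruxes.Target.PolyconstantOmegaSplit
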